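import Summits.BirchSwinnertonDyer.BirchSwinnertonDyer.Theses.ShadowIsolation
import Summits.BirchSwinnertonDyer.BirchSwinnertonDyer.Theses.SelmerRank
import Summits.BirchSwinnertonDyer.BirchSwinnertonDyer.Theorems.SelmerRankShaCorank
import Literature.NumberTheory.EllipticCurves.BSDSelmer
import Literature.NumberTheory.EllipticCurves.BSDSelmerParityDokchitserProofs
import Literature.NumberTheory.EllipticCurves.BSDSelmerCMPConverseKLevelProofs
import Literature.NumberTheory.EllipticCurves.LeadingTerm

/-!
# Negative lemmas for crux `SelmerRankUB` (stmt-BirchSwinnertonDyer-0130):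
# the shape, parity gap and first open cell of any counterexample

Crux-disprover file (Negative lane, `--supports stmt-BirchSwinnertonDyer-0130`; it does NOT refute
the crux, asserts no route statement positively, and introduces no definition). The crux (route
ShadowIsolation; the copy `SelmerRank.SelmerRankUB` is `rfl`-equal, `shadowIsolation_selmerRankUB_iff`)
is

  `∀ W [IsElliptic] [IsGloballyMinimal] p [p.Prime], 5 ≤ p → good at p → p ∤ a_p(W) → ρ̄_{W,p} onto →
     corank_{ℤ_p} Sel_{p^∞}(W/ℚ) ≤ r_an(W)`.

Kernel-checked findings of the standing disprover (cycle 1; full record in the crux work-file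
`Cruxes/SelmerRankUB/Disproof.lean`):

* §1 SHAPE (unconditional, via the tree theorem `corank Sel_{p^∞} = rank + corank Ш[p^∞]`,
  `WeierstrassCurve.selmerCorank_eq_mordellWeilRank_add_holds`, Greenberg LNM 1716 §1):
  `¬ SelmerRankUB ↔ ∃ (W, p) in the hypothesis block with r_an < rank + corank Ш[p^∞]`
  (`not_selmerRankUB_iff`); pointwise a failure is EXCESS RANK (`r_an < rank`, i.e. `¬` BSD-rank)
  or a DIVISIBLE Ш (`0 < corank Ш[p^∞]`, i.e. `Ш[p^∞]` infinite) — `excessRank_or_divisibleSha_of_failure`.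
* §2 NO HYPOTHESIS IS LOAD-BEARING FOR TRUTH: the summit `BirchSwinnertonDyer` (`r_an = rank`) and the
  sibling crux `SelmerRank.SelmerRankShaPFinite` (`Ш[p^∞]` finite, stmt-0132) give the conclusion for
  EVERY elliptic `W` and EVERY prime `p` — bad, supersingular, `2`, `3`, Eisenstein, non-minimal
  included (`selmerCorank_le_analyticRank_of_summit_of_shaPFinite`); so a counterexample to the crux OR
  TO ANY WEAKENING OF ITS FIVE HYPOTHESES refutes the summit or Ш-finiteness
  (`not_summit_or_not_shaPFinite_of_selmerCorank_gt`, `…_of_not_selmerRankUB`): no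
  `selmerRankUB_false_without_<H>` lemma can exist short of that, and the crux cannot be
  "refuted-misstated".
* §3 PARITY GAP (modulo the `p`-parity fact `selmerCorank_mod_two_eq`, bsd.S19, Dokchitser–Dokchitser
  2010 Thm 1.4): a failure overshoots by two, `r_an + 2 ≤ corank_p` (`gap_two_of_parity`); the crux at
  `(W, p)` is equivalent to the a priori weaker `corank_p ≤ r_an + 1` (`le_iff_le_add_one_of_parity`).
* §4 FIRST OPEN CELL (modulo Gross–Zagier–Kolyvagin `rank_eq_analyticRank_of_analyticRank_le_one`,
  bsd.S17): every failure has `r_an ≥ 2` (`two_le_analyticRank_of_failure`) and `corank_p ≥ 4`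
  (`four_le_selmerCorank_of_failure`); `counterexample_profile` assembles the minimal profile:
  NON-CM (`not_hasCM_of_hasSurjectiveModNGaloisRep_of_five_le`, Serre 1972 §4.5), big-image good
  ordinary `p ≥ 5`, `r_an ≥ 2`, `rank + corank Ш[p^∞] ≥ r_an + 2`, `corank_p ≥ 4`. The cheapest
  conceivable witness is therefore a curve with four independent points, `w = +1`, `L(E,1) = 0`,
  `L''(E,1) ≠ 0`; the numerical scan of the rank-record curves of ranks 2–7 (kit job `j026907`,
  evidence on the item) finds `|L^{(j)}(E,1)/j!| < 2·10⁻³⁴` for all `j < rank` — no witness.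
* §5 SCOPE: the hypothesis block binds no CM curve, so the crux is equivalent to its restriction to
  non-CM `W` (`selmerRankUB_iff_nonCM`); the CM sector is the sibling item `SelmerRankCM`.
[folklore]
-/

-- the problem directory `BirchSwinnertonDyer/BirchSwinnertonDyer` forces the duplicated namespace segment
set_option linter.dupNamespace false

noncomputable section

namespace Summit.BirchSwinnertonDyer.BirchSwinnertonDyer.Theorems

open Summit.BirchSwinnertonDyer.BirchSwinnertonDyer.Theses
open Summit.BirchSwinnertonDyer.BirchSwinnertonDyer.Theses.ShadowIsolation (SelmerRankUB)
open Literature.NumberTheory.EllipticCurves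

/-! ## §0 The two route copies agree -/

/-- The ShadowIsolation and SelmerRank copies of the crux are definitionally equal. [folklore] -/
theorem SelmerRankUBNegative.shadowIsolation_selmerRankUB_iff :
    ShadowIsolation.SelmerRankUB ↔ SelmerRank.SelmerRankUB := Iff.rfl

/-! ## §1 Counterexample shape (unconditional) -/

/-- **What a disproof must produce.** `¬ SelmerRankUB` is EQUIVALENT to the existence of a globally
minimal elliptic `W/ℚ` and a big-image good ordinary prime `p ≥ 5` with
`r_an < rank E(ℚ) + corank_{ℤ_p} Ш[p^∞]` (Greenberg's identity, tree theorem
`WeierstrassCurve.selmerCorank_eq_mordellWeilRank_add_holds`). [cite: GreenbergLNM1716, §1] -/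
theorem SelmerRankUBNegative.not_selmerRankUB_iff :
    ¬ SelmerRankUB ↔
      ∃ (W : WeierstrassCurve ℚ) (_ : W.IsElliptic) (_ : W.IsGloballyMinimal) (p : ℕ)
        (_ : Fact p.Prime), 5 ≤ p ∧ W.HasGoodReductionAtPrime p ∧ ¬ (p : ℤ) ∣ W.frobeniusTrace p ∧
          W.HasSurjectiveModNGaloisRep p ∧ W.analyticRank < W.mordellWeilRank + W.shaCorank p := by
  constructor
  · intro h
    by_contra hne
    apply h
    intro W _ _ p _ h5 hg ho hs
    by_contra hlt
    apply hne
    refine ⟨W, inferInstance, inferInstance, p, inferInstance, h5, hg, ho, hs, ?_⟩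
    have h2 : W.selmerCorank p = W.mordellWeilRank + W.shaCorank p :=
      W.selmerCorank_eq_mordellWeilRank_add_holds p
    omega
  · rintro ⟨W, _, _, p, _, h5, hg, ho, hs, hlt⟩ h
    have h1 := h W p h5 hg ho hs
    have h2 : W.selmerCorank p = W.mordellWeilRank + W.shaCorank p :=
      W.selmerCorank_eq_mordellWeilRank_add_holds p
    omega

/-- **Pointwise dichotomy**: at a failing pair `(W, p)` either the RANK is excessive (`rank > r_an`,
a counterexample to BSD-rank) or `Ш[p^∞]` has POSITIVE `ℤ_p`-corank (an infinite, divisible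
`Ш[p^∞]`, a counterexample to the finiteness of Ш). [cite: GreenbergLNM1716, §1] -/
theorem SelmerRankUBNegative.excessRank_or_divisibleSha_of_failure (W : WeierstrassCurve ℚ)
    [W.IsElliptic] (p : ℕ) [Fact p.Prime] (h : ¬ W.selmerCorank p ≤ W.analyticRank) :
    W.analyticRank < W.mordellWeilRank ∨ 0 < W.shaCorank p := by
  have h2 : W.selmerCorank p = W.mordellWeilRank + W.shaCorank p :=
    W.selmerCorank_eq_mordellWeilRank_add_holds p
  omega

/-! ## §2 Load-bearing analysis: no hypothesis is load-bearing for truth -/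

/-- **The crux with EVERY hypothesis dropped follows from the summit and Ш-finiteness**: if
`r_an = rank` for all elliptic `W/ℚ` (the Lean summit) and `Ш(W/ℚ)[p^∞]` is finite for all `(W, p)`
(the sibling crux `SelmerRank.SelmerRankShaPFinite`), then `corank_{ℤ_p} Sel_{p^∞}(W/ℚ) ≤ r_an(W)`
for every elliptic `W` and every prime `p` — no `p ≥ 5`, no good / ordinary reduction, no image
condition, no minimality. [cite: GreenbergLNM1716, §1] -/
theorem SelmerRankUBNegative.selmerCorank_le_analyticRank_of_summit_of_shaPFinite
    (hS : _root_.BirchSwinnertonDyer) (hSha : SelmerRank.SelmerRankShaPFinite)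
    (W : WeierstrassCurve ℚ) [W.IsElliptic] (p : ℕ) [Fact p.Prime] :
    W.selmerCorank p ≤ W.analyticRank := by
  have h0 : W.analyticRank = W.mordellWeilRank := hS W inferInstance
  have h2 : W.selmerCorank p = W.mordellWeilRank + W.shaCorank p :=
    W.selmerCorank_eq_mordellWeilRank_add_holds p
  have h3 : W.shaCorank p = 0 := Literature.BSD.shaCorank_eq_zero_of_finite W p (hSha W p)
  omega

/-- **One pair `(W, p)` with `r_an(W) < corank_p Sel_{p^∞}(W/ℚ)` refutes the summit or the
finiteness of `Ш[p^∞]`** — whatever the reduction type of `p`, the image of `ρ̄_{W,p}` or the model.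
This is the only shape a counterexample to the crux, or to ANY weakening of its five hypotheses, can
have; hence no `selmerRankUB_false_without_<H>` lemma exists for any hypothesis `H` unless
`¬ BirchSwinnertonDyer ∨ ¬ SelmerRankShaPFinite` is a theorem. [cite: GreenbergLNM1716, §1] -/
theorem SelmerRankUBNegative.not_summit_or_not_shaPFinite_of_selmerCorank_gt (W : WeierstrassCurve ℚ)
    [W.IsElliptic] (p : ℕ) [Fact p.Prime] (hlt : W.analyticRank < W.selmerCorank p) :
    ¬ _root_.BirchSwinnertonDyer ∨ ¬ SelmerRank.SelmerRankShaPFinite := by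
  by_contra h
  push Not at h
  have := SelmerRankUBNegative.selmerCorank_le_analyticRank_of_summit_of_shaPFinite h.1 h.2 W p
  omega

/-- **A counterexample to the crux refutes the summit or Ш-finiteness** (none of the five
hypotheses used): the crux cannot be "refuted-misstated". [cite: GreenbergLNM1716, §1] -/
theorem SelmerRankUBNegative.not_summit_or_not_shaPFinite_of_not_selmerRankUB (h : ¬ SelmerRankUB) :
    ¬ _root_.BirchSwinnertonDyer ∨ ¬ SelmerRank.SelmerRankShaPFinite := by
  obtain ⟨W, _, _, p, _, -, -, -, -, hlt⟩ := SelmerRankUBNegative.not_selmerRankUB_iff.mp h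
  have h2 : W.selmerCorank p = W.mordellWeilRank + W.shaCorank p :=
    W.selmerCorank_eq_mordellWeilRank_add_holds p
  exact SelmerRankUBNegative.not_summit_or_not_shaPFinite_of_selmerCorank_gt W p (by omega)

/-! ## §3 Parity gap (modulo the `p`-parity fact bsd.S19) -/

/-- **A counterexample overshoots by at least two.** Modulo `selmerCorank_mod_two_eq W p`
(`corank_p ≡ r_an (mod 2)`, Dokchitser–Dokchitser), a failure of `corank_p ≤ r_an` forces
`r_an + 2 ≤ corank_p`: there is no "off by one" counterexample.
[cite: DokchitserDokchitserAnnals2010, Thm. 1.4] -/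
theorem SelmerRankUBNegative.gap_two_of_parity (W : WeierstrassCurve ℚ) (p : ℕ)
    (hpar : selmerCorank_mod_two_eq W p) (h : ¬ W.selmerCorank p ≤ W.analyticRank) :
    W.analyticRank + 2 ≤ W.selmerCorank p := by
  unfold selmerCorank_mod_two_eq at hpar
  omega

/-- Equivalently: modulo `p`-parity the crux at `(W, p)` is the same as the a priori weaker
`corank_p ≤ r_an + 1`. [cite: DokchitserDokchitserAnnals2010, Thm. 1.4] -/
theorem SelmerRankUBNegative.le_iff_le_add_one_of_parity (W : WeierstrassCurve ℚ) (p : ℕ)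
    (hpar : selmerCorank_mod_two_eq W p) :
    W.selmerCorank p ≤ W.analyticRank ↔ W.selmerCorank p ≤ W.analyticRank + 1 := by
  unfold selmerCorank_mod_two_eq at hpar
  omega

/-! ## §4 First open cell (modulo Gross–Zagier–Kolyvagin, bsd.S17) -/

/-- **Every failure has analytic rank ≥ 2** (modulo the GZK fact `r_an ≤ 1 ⇒ rank = r_an ∧ Ш finite`,
through the tree theorem `selmerCorank_eq_analyticRank_of_analyticRank_le_one`).
[cite: Darmon2004, Thm. 3.22] -/
theorem SelmerRankUBNegative.two_le_analyticRank_of_failure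
    (hGZK : rank_eq_analyticRank_of_analyticRank_le_one) (W : WeierstrassCurve ℚ) [W.IsElliptic]
    (p : ℕ) [Fact p.Prime] (h : ¬ W.selmerCorank p ≤ W.analyticRank) : 2 ≤ W.analyticRank := by
  by_contra hlt
  push Not at hlt
  have heq := selmerCorank_eq_analyticRank_of_analyticRank_le_one hGZK W p (by omega)
  omega

/-- **… and Selmer corank ≥ 4** (GZK + `p`-parity): the first open cell of the crux is
`corank_p Sel_{p^∞} = 4` against `r_an = 2`. [cite: DokchitserDokchitserAnnals2010, Thm. 1.4] -/
theorem SelmerRankUBNegative.four_le_selmerCorank_of_failure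
    (hGZK : rank_eq_analyticRank_of_analyticRank_le_one) (W : WeierstrassCurve ℚ) [W.IsElliptic]
    (p : ℕ) [Fact p.Prime] (hpar : selmerCorank_mod_two_eq W p)
    (h : ¬ W.selmerCorank p ≤ W.analyticRank) : 4 ≤ W.selmerCorank p := by
  have h2 := SelmerRankUBNegative.two_le_analyticRank_of_failure hGZK W p h
  have h3 := SelmerRankUBNegative.gap_two_of_parity W p hpar h
  omega

/-- **Profile of a minimal counterexample** (modulo GZK and `p`-parity): a NON-CM curve with a
big-image good ordinary `p ≥ 5`, `r_an ≥ 2`, `rank + corank Ш[p^∞] ≥ r_an + 2`, `corank_p ≥ 4`.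
[cite: DokchitserDokchitserAnnals2010, Thm. 1.4] -/
theorem SelmerRankUBNegative.counterexample_profile
    (hGZK : rank_eq_analyticRank_of_analyticRank_le_one)
    (hpar : ∀ (W : WeierstrassCurve ℚ) [W.IsElliptic] (p : ℕ) [Fact p.Prime],
      selmerCorank_mod_two_eq W p)
    (h : ¬ SelmerRankUB) :
    ∃ (W : WeierstrassCurve ℚ) (_ : W.IsElliptic) (_ : W.IsGloballyMinimal) (p : ℕ)
      (_ : Fact p.Prime), 5 ≤ p ∧ W.HasGoodReductionAtPrime p ∧ ¬ (p : ℤ) ∣ W.frobeniusTrace p ∧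
        W.HasSurjectiveModNGaloisRep p ∧ ¬ W.HasCM ∧ 2 ≤ W.analyticRank ∧
          W.analyticRank + 2 ≤ W.mordellWeilRank + W.shaCorank p ∧ 4 ≤ W.selmerCorank p := by
  obtain ⟨W, _, _, p, _, h5, hg, ho, hs, hlt⟩ := SelmerRankUBNegative.not_selmerRankUB_iff.mp h
  have hid : W.selmerCorank p = W.mordellWeilRank + W.shaCorank p :=
    W.selmerCorank_eq_mordellWeilRank_add_holds p
  have hfail : ¬ W.selmerCorank p ≤ W.analyticRank := by omega
  refine ⟨W, inferInstance, inferInstance, p, inferInstance, h5, hg, ho, hs,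
    not_hasCM_of_hasSurjectiveModNGaloisRep_of_five_le W p h5 hg ho hs,
    SelmerRankUBNegative.two_le_analyticRank_of_failure hGZK W p hfail, ?_,
    SelmerRankUBNegative.four_le_selmerCorank_of_failure hGZK W p (hpar W p) hfail⟩
  have := SelmerRankUBNegative.gap_two_of_parity W p (hpar W p) hfail
  omega

/-! ## §5 Scope: the crux binds no CM curve -/

/-- **The crux is silent on CM curves**: restricting it to non-CM `W` changes nothing, because a
curve with a surjective `ρ̄_{E,p}` at a good ordinary `p ≥ 5` has no CM (tree theorem
`not_hasCM_of_hasSurjectiveModNGaloisRep_of_five_le`, Serre 1972 §4.5). [cite: Serre1972, §4.5] -/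
theorem SelmerRankUBNegative.selmerRankUB_iff_nonCM :
    SelmerRankUB ↔
      ∀ (W : WeierstrassCurve ℚ) [W.IsElliptic] [W.IsGloballyMinimal] (p : ℕ) [Fact p.Prime],
        ¬ W.HasCM → 5 ≤ p → W.HasGoodReductionAtPrime p → ¬ (p : ℤ) ∣ W.frobeniusTrace p →
          W.HasSurjectiveModNGaloisRep p → W.selmerCorank p ≤ W.analyticRank :=
  ⟨fun h W _ _ p _ _ h5 hg ho hs => h W p h5 hg ho hs, fun h W _ _ p _ h5 hg ho hs =>
    h W p (not_hasCM_of_hasSurjectiveModNGaloisRep_of_five_le W p h5 hg ho hs) h5 hg ho hs⟩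

end Summit.BirchSwinnertonDyer.BirchSwinnertonDyer.Theorems

end
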